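import Literature.MathematicalPhysics.QuantumFieldTheory.Balaban1983to89.MassGapOpenBoundaryLipschitz
import HarnessLib

/-!
# Typed sufficient conditions for the Jaffe–Witten lattice mass-gap clause, §24: the CONVERSE — JW's transfer gap
# at rate `m` ⇒ open-boundary time clustering of every bounded slice observable at rate `m`; hence EQUIVALENCE

HONEST FRAMING (audit package `pub-balaban`, seat `b2b-balaban-ir-2`, generation 15, 2026-08-19).  This module is
§24 of the lineage `Balaban1983to89/MassGapFunctionalInequalities.lean`.  §22–§23 proved one direction of the
dictionary between the output a volume-uniform OPEN-temporal-boundary functional inequality would have (§21's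
hypothesis schema `OpenBoundaryTimeClustering`: uniform-in-`(s, T)` exponential clustering at lattice rate `m` of the
Lüscher–Schaefer open-boundary expectations of slice observables) and the Jaffe–Witten lattice currency
(`TransferOperatorGap`: the gap `e^{−m}` of Lüscher's transfer matrix below its simple top eigenvalue).  This module
proves the CONVERSE, so that the census can price the hypothesis exactly: on every spatial torus `(ℤ/(2S+1))³`, for
continuous unitary `ρ`, `β ≥ 0` and `m > 0`,

  `OpenBoundaryTimeClustering ρ β (2S+1) (boundedMeasurableClass (2S+1)) m ↔ TransferOperatorGap ρ β S m`
  (`openBoundaryTimeClustering_iff_transferOperatorGap`); for faithful `ρ` the same with the gauge-invariant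
  Wilson-loop-polynomial class or the gauge-invariant `ρ`-Lipschitz class of §23 in place of all bounded measurable
  functions (`openBoundaryTimeClustering_polynomialClass_iff`, `openBoundaryTimeClustering_lipschitzClass_iff`);
  and `GroundStateClustering ρ β S m ↔ TransferOperatorGap ρ β S m` (`groundStateClustering_iff_transferOperatorGap`).

So the typed statement "what a weak-coupling, volume-uniform functional inequality would have to say" is neither
weaker nor stronger than the lattice mass gap itself, torus by torus and with the same rate: an open-boundary
inequality of natural size uniformly in the volume IS (the transfer-axis half of) the Jaffe–Witten clause in other
clothes; the observable class (all bounded measurable functions, or just Wilson-loop polynomials) is immaterial.  This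
is a dictionary and a census statement.  NOTHING about Yang–Mills is proved or excluded: whether either side holds
for 4-d `SU(N)` at weak coupling uniformly in `S` is exactly what is not known.  EXPLICITLY A LOTTERY; value = typed
dictionary.

ABSOLUTE RULE bookkeeping: every declaration is a `def` (one observable class) or a [folklore] theorem proved here
from §12/§21/§22/§23 and the tree's Perron–Frobenius–Jentzsch facts; no published theorem is used as a hypothesis.

Contents.
* §24a (abstract real Hilbert space `E`): the RANK-ONE APPROXIMATION ESTIMATE `abs_corrNumerator_le` — if `B` is
  within `ε` of the rank-one map `z ↦ Λ⟪φ, z⟫φ` (`‖Bz − Λ⟪φ,z⟫φ‖ ≤ ε‖z‖`, `‖Bz‖ ≤ Λ‖z‖`), then for all `X, Y` and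
  every bounded `M` the connected numerator `⟪BX, Y⟫⟪X, MBMY⟫ − ⟪X, MBY⟫⟪BX, MY⟫` is at most
  `4 Λ ε ‖M‖² ‖X‖² ‖Y‖²` (the rank-one parts cancel identically); the UNIFORM LOWER BOUND
  `exists_pos_mul_pow_le_inner_pow` — under the power-iteration gap `‖Aⁿg − ‖A‖ⁿ⟪φ,g⟫φ‖ ≤ θⁿ‖g‖`, `θ < ‖A‖`, a
  boundary vector `e` with `⟪φ, e⟫ ≠ 0` and `⟪Aᵀe, e⟫ > 0` for all `T` has `⟪Aᵀe, e⟫ ≥ δ‖A‖ᵀ` (`δ > 0`); and their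
  combination `exists_abs_openRatio_le_of_gap`: with `D = ⟪AᵗAˢe, Aʳe⟫ = ⟪A^{r+t+s}e, e⟫`,
  `|⟪Aˢe, MAᵗMAʳe⟫/D − (⟪Aˢe, MAᵗAʳe⟫/D)(⟪AᵗAˢe, MAʳe⟫/D)| ≤ K (θ/‖A‖)ᵗ` UNIFORMLY in `r, s`
  (`K = 4‖M‖²(|⟪φ,e⟫| + ‖e‖)⁴/δ²`).
* §24a′ (abstract probability space, §22c's moments): `exists_abs_insMomentRatio_le_of_gap` — the same bound for
  `insMoment μ K f (r+t+s) {s,s+t} / insMoment … ∅ − (… {s} / … ∅)(… {s+t} / … ∅)`.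
* §24b (Wilson's theory): `boundedMeasurableClass`; **`openBoundaryTimeClustering_of_transferOperatorGap`**
  (continuous unitary `ρ`, ANY real `β`, `m > 0`: `TransferOperatorGap ρ β S m → OpenBoundaryTimeClustering ρ β
  (2S+1) 𝒞 m` for every class `𝒞` of bounded measurable slice functions — `⟪Ω, 𝟙⟫ ≠ 0` and `Z^{open}(T) > 0` come
  from positivity improvement (tree `IsPositivityImproving.top_eigenvector_abs`) and §21's
  `openPartitionFunction_pos`); the four equivalences listed above; `groundStateClustering_of_transferOperatorGap`
  (any real `β`); the class lemmas `polynomialInvariantClass_subset_boundedMeasurableClass`,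
  `lipschitzInvariantClass_subset_boundedMeasurableClass`,
  `openBoundaryTimeClustering_boundedMeasurableClass_of_polynomialClass`.

References (orientation only; nothing is cited as a hypothesis): I. Montvay, G. Münster, *Quantum Fields on a
Lattice* (1994), §3.2.6, (3.145) and (3.149)–(3.152) (`𝐓ⁿ/Z → P₀`: the physicists' form of the power iteration);
M. Lüscher, S. Schaefer, JHEP 07 (2011) 036, arXiv:1105.4749, §2.4 (open temporal boundary = matrix elements of
powers of `𝕋` between boundary states).
-/

noncomputable section

open MeasureTheory Filter Function Topology
open scoped BigOperators RealInnerProductSpace ENNReal NNReal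
open Literature.Analysis.OperatorTheory Literature.MathematicalPhysics.QuantumFieldTheory

namespace Literature.MathematicalPhysics.QuantumFieldTheory.Balaban1983to89.Sufficient.OpenBoundary

/-! #### §24a The rank-one approximation estimate and the uniform lower bound (abstract real Hilbert space) -/

section AbstractHilbert

variable {E : Type*} [NormedAddCommGroup E] [InnerProductSpace ℝ E]

/-- `‖Aᵗ z‖ ≤ ‖A‖ᵗ ‖z‖`. [folklore] -/
theorem norm_pow_apply_le_pow_mul (A : E →L[ℝ] E) (z : E) : ∀ t : ℕ, ‖(A ^ t) z‖ ≤ ‖A‖ ^ t * ‖z‖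
  | 0 => by simp
  | t + 1 => by
    rw [pow_succ', mul_apply_eq_comp]
    calc ‖A ((A ^ t) z)‖ ≤ ‖A‖ * ‖(A ^ t) z‖ := A.le_opNorm _
      _ ≤ ‖A‖ * (‖A‖ ^ t * ‖z‖) := mul_le_mul_of_nonneg_left (norm_pow_apply_le_pow_mul A z t) (norm_nonneg _)
      _ = ‖A‖ ^ (t + 1) * ‖z‖ := by ring

/-- **Rank-one approximation estimate.**  If `B` is within `ε` of the rank-one map `z ↦ Λ⟪φ,z⟫φ` (`φ` a unit vector) and
`‖Bz‖ ≤ Λ‖z‖`, then for every bounded `M` and all `X, Y` the connected numerator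
`⟪BX, Y⟫ ⟪X, M(B(MY))⟫ − ⟪X, M(BY)⟫ ⟪BX, MY⟫` is at most `4 Λ ε ‖M‖² ‖X‖² ‖Y‖²`: the rank-one contributions cancel
identically and every remaining term carries one factor `ε`. [folklore] -/
theorem abs_corrNumerator_le (M B : E →L[ℝ] E) {φ : E} (hφ : ‖φ‖ = 1) {Λ ε : ℝ} (hΛ : 0 ≤ Λ) (hε : 0 ≤ ε)
    (hR : ∀ z, ‖B z - (Λ * ⟪φ, z⟫) • φ‖ ≤ ε * ‖z‖) (hB : ∀ z, ‖B z‖ ≤ Λ * ‖z‖) (X Y : E) :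
    |⟪B X, Y⟫ * ⟪X, M (B (M Y))⟫ - ⟪X, M (B Y)⟫ * ⟪B X, M Y⟫| ≤
      4 * Λ * ε * ‖M‖ ^ 2 * ‖X‖ ^ 2 * ‖Y‖ ^ 2 := by
  have hmul : ∀ {a b a' b' : ℝ}, |a| ≤ a' → |b| ≤ b' → |a * b| ≤ a' * b' := fun ha hb => by
    rw [abs_mul]
    exact mul_le_mul ha hb (abs_nonneg _) ((abs_nonneg _).trans ha)
  -- the four error terms
  have he₂ : ⟪X, M (B (M Y))⟫ - Λ * ⟪φ, M Y⟫ * ⟪X, M φ⟫ = ⟪X, M (B (M Y) - (Λ * ⟪φ, M Y⟫) • φ)⟫ := by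
    rw [map_sub, map_smul, inner_sub_right, real_inner_smul_right]
  have he₁ : ⟪X, M (B Y)⟫ - Λ * ⟪φ, Y⟫ * ⟪X, M φ⟫ = ⟪X, M (B Y - (Λ * ⟪φ, Y⟫) • φ)⟫ := by
    rw [map_sub, map_smul, inner_sub_right, real_inner_smul_right]
  have he₃ : ⟪B X, M Y⟫ - Λ * ⟪φ, X⟫ * ⟪φ, M Y⟫ = ⟪B X - (Λ * ⟪φ, X⟫) • φ, M Y⟫ := by
    rw [inner_sub_left, real_inner_smul_left]
  have he₀ : ⟪B X, Y⟫ - Λ * ⟪φ, X⟫ * ⟪φ, Y⟫ = ⟪B X - (Λ * ⟪φ, X⟫) • φ, Y⟫ := by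
    rw [inner_sub_left, real_inner_smul_left]
  have hMφ : ‖M φ‖ ≤ ‖M‖ := by simpa [hφ] using M.le_opNorm φ
  -- bounds on the error terms
  have hb₂ : |⟪X, M (B (M Y))⟫ - Λ * ⟪φ, M Y⟫ * ⟪X, M φ⟫| ≤ ‖X‖ * (‖M‖ * (ε * (‖M‖ * ‖Y‖))) := by
    rw [he₂]
    calc |⟪X, M (B (M Y) - (Λ * ⟪φ, M Y⟫) • φ)⟫| ≤ ‖X‖ * ‖M (B (M Y) - (Λ * ⟪φ, M Y⟫) • φ)‖ :=
          abs_real_inner_le_norm _ _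
      _ ≤ ‖X‖ * (‖M‖ * ‖B (M Y) - (Λ * ⟪φ, M Y⟫) • φ‖) :=
          mul_le_mul_of_nonneg_left (M.le_opNorm _) (norm_nonneg _)
      _ ≤ ‖X‖ * (‖M‖ * (ε * ‖M Y‖)) :=
          mul_le_mul_of_nonneg_left (mul_le_mul_of_nonneg_left (hR _) (norm_nonneg _)) (norm_nonneg _)
      _ ≤ ‖X‖ * (‖M‖ * (ε * (‖M‖ * ‖Y‖))) :=
          mul_le_mul_of_nonneg_left (mul_le_mul_of_nonneg_left
            (mul_le_mul_of_nonneg_left (M.le_opNorm _) hε) (norm_nonneg _)) (norm_nonneg _)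
  have hb₁ : |⟪X, M (B Y)⟫ - Λ * ⟪φ, Y⟫ * ⟪X, M φ⟫| ≤ ‖X‖ * (‖M‖ * (ε * ‖Y‖)) := by
    rw [he₁]
    calc |⟪X, M (B Y - (Λ * ⟪φ, Y⟫) • φ)⟫| ≤ ‖X‖ * ‖M (B Y - (Λ * ⟪φ, Y⟫) • φ)‖ := abs_real_inner_le_norm _ _
      _ ≤ ‖X‖ * (‖M‖ * ‖B Y - (Λ * ⟪φ, Y⟫) • φ‖) := mul_le_mul_of_nonneg_left (M.le_opNorm _) (norm_nonneg _)
      _ ≤ ‖X‖ * (‖M‖ * (ε * ‖Y‖)) :=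
          mul_le_mul_of_nonneg_left (mul_le_mul_of_nonneg_left (hR _) (norm_nonneg _)) (norm_nonneg _)
  have hb₃ : |⟪B X, M Y⟫ - Λ * ⟪φ, X⟫ * ⟪φ, M Y⟫| ≤ ε * ‖X‖ * (‖M‖ * ‖Y‖) := by
    rw [he₃]
    calc |⟪B X - (Λ * ⟪φ, X⟫) • φ, M Y⟫| ≤ ‖B X - (Λ * ⟪φ, X⟫) • φ‖ * ‖M Y‖ := abs_real_inner_le_norm _ _
      _ ≤ ε * ‖X‖ * (‖M‖ * ‖Y‖) := mul_le_mul (hR _) (M.le_opNorm _) (norm_nonneg _) (mul_nonneg hε (norm_nonneg _))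
  have hb₀ : |⟪B X, Y⟫ - Λ * ⟪φ, X⟫ * ⟪φ, Y⟫| ≤ ε * ‖X‖ * ‖Y‖ := by
    rw [he₀]
    calc |⟪B X - (Λ * ⟪φ, X⟫) • φ, Y⟫| ≤ ‖B X - (Λ * ⟪φ, X⟫) • φ‖ * ‖Y‖ := abs_real_inner_le_norm _ _
      _ ≤ ε * ‖X‖ * ‖Y‖ := mul_le_mul_of_nonneg_right (hR _) (norm_nonneg _)
  -- bounds on the rank-one coefficients and on the two full matrix elements
  have hαX : |⟪φ, X⟫| ≤ ‖X‖ := by simpa [hφ] using abs_real_inner_le_norm φ X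
  have hαY : |⟪φ, Y⟫| ≤ ‖Y‖ := by simpa [hφ] using abs_real_inner_le_norm φ Y
  have hμ : |⟪X, M φ⟫| ≤ ‖X‖ * ‖M‖ :=
    (abs_real_inner_le_norm _ _).trans (mul_le_mul_of_nonneg_left hMφ (norm_nonneg _))
  have hν : |⟪φ, M Y⟫| ≤ ‖M‖ * ‖Y‖ := by
    have h := abs_real_inner_le_norm φ (M Y)
    rw [hφ, one_mul] at h
    exact h.trans (M.le_opNorm _)
  have hn₂ : |⟪X, M (B (M Y))⟫| ≤ ‖X‖ * (‖M‖ * (Λ * (‖M‖ * ‖Y‖))) := by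
    calc |⟪X, M (B (M Y))⟫| ≤ ‖X‖ * ‖M (B (M Y))‖ := abs_real_inner_le_norm _ _
      _ ≤ ‖X‖ * (‖M‖ * ‖B (M Y)‖) := mul_le_mul_of_nonneg_left (M.le_opNorm _) (norm_nonneg _)
      _ ≤ ‖X‖ * (‖M‖ * (Λ * ‖M Y‖)) :=
          mul_le_mul_of_nonneg_left (mul_le_mul_of_nonneg_left (hB _) (norm_nonneg _)) (norm_nonneg _)
      _ ≤ ‖X‖ * (‖M‖ * (Λ * (‖M‖ * ‖Y‖))) :=
          mul_le_mul_of_nonneg_left (mul_le_mul_of_nonneg_left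
            (mul_le_mul_of_nonneg_left (M.le_opNorm _) hΛ) (norm_nonneg _)) (norm_nonneg _)
  have hn₃ : |⟪B X, M Y⟫| ≤ Λ * ‖X‖ * (‖M‖ * ‖Y‖) := by
    calc |⟪B X, M Y⟫| ≤ ‖B X‖ * ‖M Y‖ := abs_real_inner_le_norm _ _
      _ ≤ Λ * ‖X‖ * (‖M‖ * ‖Y‖) := mul_le_mul (hB _) (M.le_opNorm _) (norm_nonneg _) (mul_nonneg hΛ (norm_nonneg _))
  have hΛabs : |Λ| ≤ Λ := (abs_of_nonneg hΛ).le
  -- the exact cancellation of the rank-one parts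
  have hid : ⟪B X, Y⟫ * ⟪X, M (B (M Y))⟫ - ⟪X, M (B Y)⟫ * ⟪B X, M Y⟫ =
      Λ * ⟪φ, X⟫ * ⟪φ, Y⟫ * (⟪X, M (B (M Y))⟫ - Λ * ⟪φ, M Y⟫ * ⟪X, M φ⟫) +
        (⟪B X, Y⟫ - Λ * ⟪φ, X⟫ * ⟪φ, Y⟫) * ⟪X, M (B (M Y))⟫ -
        Λ * ⟪φ, Y⟫ * ⟪X, M φ⟫ * (⟪B X, M Y⟫ - Λ * ⟪φ, X⟫ * ⟪φ, M Y⟫) -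
        (⟪X, M (B Y)⟫ - Λ * ⟪φ, Y⟫ * ⟪X, M φ⟫) * ⟪B X, M Y⟫ := by
    ring
  -- the four products, each at most `Q = Λ ε ‖M‖² ‖X‖² ‖Y‖²`
  have hT₁ : |Λ * ⟪φ, X⟫ * ⟪φ, Y⟫ * (⟪X, M (B (M Y))⟫ - Λ * ⟪φ, M Y⟫ * ⟪X, M φ⟫)| ≤
      Λ * ε * ‖M‖ ^ 2 * ‖X‖ ^ 2 * ‖Y‖ ^ 2 :=
    (hmul (hmul (hmul hΛabs hαX) hαY) hb₂).trans
      (le_of_eq (by ring))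
  have hT₂ : |(⟪B X, Y⟫ - Λ * ⟪φ, X⟫ * ⟪φ, Y⟫) * ⟪X, M (B (M Y))⟫| ≤ Λ * ε * ‖M‖ ^ 2 * ‖X‖ ^ 2 * ‖Y‖ ^ 2 :=
    (hmul hb₀ hn₂).trans (le_of_eq (by ring))
  have hT₃ : |Λ * ⟪φ, Y⟫ * ⟪X, M φ⟫ * (⟪B X, M Y⟫ - Λ * ⟪φ, X⟫ * ⟪φ, M Y⟫)| ≤
      Λ * ε * ‖M‖ ^ 2 * ‖X‖ ^ 2 * ‖Y‖ ^ 2 :=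
    (hmul (hmul (hmul hΛabs hαY) hμ) hb₃).trans
      (le_of_eq (by ring))
  have hT₄ : |(⟪X, M (B Y)⟫ - Λ * ⟪φ, Y⟫ * ⟪X, M φ⟫) * ⟪B X, M Y⟫| ≤ Λ * ε * ‖M‖ ^ 2 * ‖X‖ ^ 2 * ‖Y‖ ^ 2 :=
    (hmul hb₁ hn₃).trans (le_of_eq (by ring))
  rw [hid]
  refine abs_le.2 ⟨?_, ?_⟩
  · linarith [neg_abs_le (Λ * ⟪φ, X⟫ * ⟪φ, Y⟫ * (⟪X, M (B (M Y))⟫ - Λ * ⟪φ, M Y⟫ * ⟪X, M φ⟫)),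
      neg_abs_le ((⟪B X, Y⟫ - Λ * ⟪φ, X⟫ * ⟪φ, Y⟫) * ⟪X, M (B (M Y))⟫),
      le_abs_self (Λ * ⟪φ, Y⟫ * ⟪X, M φ⟫ * (⟪B X, M Y⟫ - Λ * ⟪φ, X⟫ * ⟪φ, M Y⟫)),
      le_abs_self ((⟪X, M (B Y)⟫ - Λ * ⟪φ, Y⟫ * ⟪X, M φ⟫) * ⟪B X, M Y⟫)]
  · linarith [le_abs_self (Λ * ⟪φ, X⟫ * ⟪φ, Y⟫ * (⟪X, M (B (M Y))⟫ - Λ * ⟪φ, M Y⟫ * ⟪X, M φ⟫)),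
      le_abs_self ((⟪B X, Y⟫ - Λ * ⟪φ, X⟫ * ⟪φ, Y⟫) * ⟪X, M (B (M Y))⟫),
      neg_abs_le (Λ * ⟪φ, Y⟫ * ⟪X, M φ⟫ * (⟪B X, M Y⟫ - Λ * ⟪φ, X⟫ * ⟪φ, M Y⟫)),
      neg_abs_le ((⟪X, M (B Y)⟫ - Λ * ⟪φ, Y⟫ * ⟪X, M φ⟫) * ⟪B X, M Y⟫)]

variable {A : E →L[ℝ] E} {φ e : E} {θ : ℝ}

/-- **Uniform lower bound on the open partition function** (abstract).  Under the power-iteration gap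
`‖Aⁿ g − ‖A‖ⁿ⟪φ, g⟫ φ‖ ≤ θⁿ ‖g‖` with `θ < ‖A‖` (`φ` a unit vector), a boundary vector `e` with `⟪φ, e⟫ ≠ 0` whose
"partition functions" `⟪Aᵀ e, e⟫` are all positive has `⟪Aᵀ e, e⟫ ≥ δ ‖A‖ᵀ` for one `δ > 0` and every `T`:
`⟪Aᵀe, e⟫/‖A‖ᵀ → ⟪φ, e⟫² > 0`, and the finitely many earlier values are positive. [folklore] -/
theorem exists_pos_mul_pow_le_inner_pow (hθ0 : 0 ≤ θ) (hθ : θ < ‖A‖)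
    (hpow : ∀ (n : ℕ) (g : E), ‖(A ^ n) g - (‖A‖ ^ n * ⟪φ, g⟫) • φ‖ ≤ θ ^ n * ‖g‖)
    (hc : ⟪φ, e⟫ ≠ 0) (hD : ∀ T : ℕ, 0 < ⟪(A ^ T) e, e⟫) :
    ∃ δ : ℝ, 0 < δ ∧ ∀ T : ℕ, δ * ‖A‖ ^ T ≤ ⟪(A ^ T) e, e⟫ := by
  have hl : 0 < ‖A‖ := hθ0.trans_lt hθ
  have hq0 : 0 ≤ θ / ‖A‖ := div_nonneg hθ0 hl.le
  have hq1 : θ / ‖A‖ < 1 := (div_lt_one hl).2 hθ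
  have hc2 : 0 < ⟪φ, e⟫ ^ 2 := lt_of_le_of_ne (sq_nonneg _) (Ne.symm (pow_ne_zero 2 hc))
  -- the normalised partition functions and their lower bound
  have hdpos : ∀ T : ℕ, 0 < ⟪(A ^ T) e, e⟫ / ‖A‖ ^ T := fun T => div_pos (hD T) (pow_pos hl T)
  have hdlow : ∀ T : ℕ, ⟪φ, e⟫ ^ 2 - (θ / ‖A‖) ^ T * ‖e‖ ^ 2 ≤ ⟪(A ^ T) e, e⟫ / ‖A‖ ^ T := by
    intro T
    have h1 : ⟪(A ^ T) e, e⟫ = ‖A‖ ^ T * ⟪φ, e⟫ ^ 2 + ⟪(A ^ T) e - (‖A‖ ^ T * ⟪φ, e⟫) • φ, e⟫ := by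
      rw [inner_sub_left, real_inner_smul_left]
      ring
    have h2 : |⟪(A ^ T) e - (‖A‖ ^ T * ⟪φ, e⟫) • φ, e⟫| ≤ θ ^ T * ‖e‖ * ‖e‖ :=
      (abs_real_inner_le_norm _ _).trans (mul_le_mul_of_nonneg_right (hpow T e) (norm_nonneg _))
    have h3 : ‖A‖ ^ T * ⟪φ, e⟫ ^ 2 - θ ^ T * ‖e‖ ^ 2 ≤ ⟪(A ^ T) e, e⟫ := by
      rw [h1]
      have h4 := neg_abs_le ⟪(A ^ T) e - (‖A‖ ^ T * ⟪φ, e⟫) • φ, e⟫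
      nlinarith [h2, h4]
    rw [le_div_iff₀ (pow_pos hl T)]
    have h5 : (⟪φ, e⟫ ^ 2 - (θ / ‖A‖) ^ T * ‖e‖ ^ 2) * ‖A‖ ^ T = ‖A‖ ^ T * ⟪φ, e⟫ ^ 2 - θ ^ T * ‖e‖ ^ 2 := by
      rw [div_pow]
      field_simp
    rw [h5]
    exact h3
  -- eventually the normalised partition functions are at least `⟪φ, e⟫²/2`
  have h0 : Tendsto (fun T : ℕ => (θ / ‖A‖) ^ T * ‖e‖ ^ 2) atTop (𝓝 0) := by
    simpa using (tendsto_pow_atTop_nhds_zero_of_lt_one hq0 hq1).mul_const (‖e‖ ^ 2)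
  obtain ⟨T₀, hT₀⟩ := Filter.eventually_atTop.1 (h0.eventually (eventually_le_nhds (half_pos hc2)))
  -- the finitely many earlier ones
  set δ₀ : ℝ := (Finset.range (T₀ + 1)).inf' ⟨0, by simp⟩ fun T => ⟪(A ^ T) e, e⟫ / ‖A‖ ^ T with hδ₀
  have hδ₀pos : 0 < δ₀ := by
    rw [hδ₀, Finset.lt_inf'_iff]
    exact fun T _ => hdpos T
  refine ⟨min δ₀ (⟪φ, e⟫ ^ 2 / 2), lt_min hδ₀pos (half_pos hc2), fun T => ?_⟩
  rw [← le_div_iff₀ (pow_pos hl T)]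
  by_cases hT : T ≤ T₀
  · exact (min_le_left _ _).trans
      (Finset.inf'_le (fun T => ⟪(A ^ T) e, e⟫ / ‖A‖ ^ T) (Finset.mem_range.2 (Nat.lt_succ_of_le hT)))
  · have hT' : T₀ ≤ T := (not_le.1 hT).le
    have h6 := hT₀ T hT'
    have h7 := hdlow T
    exact (min_le_right _ _).trans (by linarith)

/-- **The open-chain connected two-time function under a gap (abstract, kernel).**  `A` self-adjoint with the
power-iteration gap at ratio `θ/‖A‖ < 1` towards the unit vector `φ`; `e` a boundary vector with `⟪φ, e⟫ ≠ 0` and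
positive partition functions `⟪Aᵀ e, e⟫ > 0`; `M` any bounded operator (the insertion).  Then ONE constant `K` (namely
`4 ‖M‖² (|⟪φ, e⟫| + ‖e‖)⁴ / δ²`) bounds, for ALL `r, t, s`,
`|⟪Aˢe, M Aᵗ M Aʳ e⟫/D − (⟪Aˢe, M AᵗAʳ e⟫/D)(⟪AᵗAˢ e, M Aʳ e⟫/D)| ≤ K (θ/‖A‖)ᵗ`, `D = ⟪AᵗAˢe, Aʳe⟫` — the converse of
§22's `inner_pow_mulL_sub_le`, uniformly in the position `s` and the trailing length `r`. [folklore] -/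
theorem exists_abs_openRatio_le_of_gap [CompleteSpace E] (hsa : IsSelfAdjoint A) (hφ1 : ‖φ‖ = 1) (hθ0 : 0 ≤ θ) (hθ : θ < ‖A‖)
    (hpow : ∀ (n : ℕ) (g : E), ‖(A ^ n) g - (‖A‖ ^ n * ⟪φ, g⟫) • φ‖ ≤ θ ^ n * ‖g‖)
    (hc : ⟪φ, e⟫ ≠ 0) (hD : ∀ T : ℕ, 0 < ⟪(A ^ T) e, e⟫) (M : E →L[ℝ] E) :
    ∃ K : ℝ, ∀ r t s : ℕ,
      |⟪(A ^ s) e, M ((A ^ t) (M ((A ^ r) e)))⟫ / ⟪(A ^ t) ((A ^ s) e), (A ^ r) e⟫ -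
          ⟪(A ^ s) e, M ((A ^ t) ((A ^ r) e))⟫ / ⟪(A ^ t) ((A ^ s) e), (A ^ r) e⟫ *
            (⟪(A ^ t) ((A ^ s) e), M ((A ^ r) e)⟫ / ⟪(A ^ t) ((A ^ s) e), (A ^ r) e⟫)| ≤
        K * (θ / ‖A‖) ^ t := by
  have hl : 0 < ‖A‖ := hθ0.trans_lt hθ
  obtain ⟨δ, hδ, hδle⟩ := exists_pos_mul_pow_le_inner_pow hθ0 hθ hpow hc hD
  -- `‖Aⁿ e‖ ≤ ‖A‖ⁿ a`
  obtain ⟨a, ha0, hae⟩ : ∃ a : ℝ, 0 ≤ a ∧ ∀ n : ℕ, ‖(A ^ n) e‖ ≤ ‖A‖ ^ n * a := by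
    refine ⟨|⟪φ, e⟫| + ‖e‖, by positivity, fun n => ?_⟩
    have h := hpow n e
    have hw : ‖(‖A‖ ^ n * ⟪φ, e⟫) • φ‖ = ‖A‖ ^ n * |⟪φ, e⟫| := by
      rw [norm_smul, hφ1, mul_one, Real.norm_eq_abs, abs_mul, abs_of_nonneg (pow_nonneg hl.le n)]
    calc ‖(A ^ n) e‖ = ‖((A ^ n) e - (‖A‖ ^ n * ⟪φ, e⟫) • φ) + (‖A‖ ^ n * ⟪φ, e⟫) • φ‖ := by
          rw [sub_add_cancel]
      _ ≤ ‖(A ^ n) e - (‖A‖ ^ n * ⟪φ, e⟫) • φ‖ + ‖(‖A‖ ^ n * ⟪φ, e⟫) • φ‖ := norm_add_le _ _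
      _ ≤ θ ^ n * ‖e‖ + ‖A‖ ^ n * |⟪φ, e⟫| := by rw [hw]; exact add_le_add h le_rfl
      _ ≤ ‖A‖ ^ n * ‖e‖ + ‖A‖ ^ n * |⟪φ, e⟫| :=
          add_le_add (mul_le_mul_of_nonneg_right (pow_le_pow_left₀ hθ0 hθ.le n) (norm_nonneg _)) le_rfl
      _ = ‖A‖ ^ n * (|⟪φ, e⟫| + ‖e‖) := by ring
  refine ⟨4 * ‖M‖ ^ 2 * a ^ 4 / δ ^ 2, fun r t s => ?_⟩
  -- the denominator is the partition function of the chain of `r + t + s` bonds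
  have hconv : ⟪(A ^ t) ((A ^ s) e), (A ^ r) e⟫ = ⟪(A ^ (r + t + s)) e, e⟫ := by
    rw [pow_add, pow_add, mul_apply_eq_comp, mul_apply_eq_comp, (hsa.pow r).isSymmetric.apply_clm]
  have hDpos : 0 < ⟪(A ^ t) ((A ^ s) e), (A ^ r) e⟫ := by rw [hconv]; exact hD _
  have hDlow : δ * ‖A‖ ^ (r + t + s) ≤ ⟪(A ^ t) ((A ^ s) e), (A ^ r) e⟫ := by rw [hconv]; exact hδle _
  have hnum := abs_corrNumerator_le M (A ^ t) hφ1 (Λ := ‖A‖ ^ t) (ε := θ ^ t) (pow_nonneg hl.le t)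
    (pow_nonneg hθ0 t) (fun z => hpow t z) (fun z => norm_pow_apply_le_pow_mul A z t) ((A ^ s) e) ((A ^ r) e)
  set D := ⟪(A ^ t) ((A ^ s) e), (A ^ r) e⟫ with hDdef
  set n₂ := ⟪(A ^ s) e, M ((A ^ t) (M ((A ^ r) e)))⟫ with hn₂
  set n₁ := ⟪(A ^ s) e, M ((A ^ t) ((A ^ r) e))⟫ with hn₁
  set n₃ := ⟪(A ^ t) ((A ^ s) e), M ((A ^ r) e)⟫ with hn₃
  have hD0 : D ≠ 0 := hDpos.ne'
  have halg : n₂ / D - n₁ / D * (n₃ / D) = (D * n₂ - n₁ * n₃) / D ^ 2 := by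
    field_simp
  rw [halg, abs_div, abs_of_pos (pow_pos hDpos 2), div_le_iff₀ (pow_pos hDpos 2)]
  have hXY : ‖(A ^ s) e‖ ^ 2 * ‖(A ^ r) e‖ ^ 2 ≤ (‖A‖ ^ s * a) ^ 2 * (‖A‖ ^ r * a) ^ 2 :=
    mul_le_mul (pow_le_pow_left₀ (norm_nonneg _) (hae s) 2) (pow_le_pow_left₀ (norm_nonneg _) (hae r) 2)
      (sq_nonneg _) (sq_nonneg _)
  have hP : 0 ≤ 4 * ‖A‖ ^ t * θ ^ t * ‖M‖ ^ 2 :=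
    mul_nonneg (mul_nonneg (mul_nonneg (by norm_num) (pow_nonneg hl.le t)) (pow_nonneg hθ0 t)) (sq_nonneg _)
  have hKq : 0 ≤ 4 * ‖M‖ ^ 2 * a ^ 4 / δ ^ 2 * (θ / ‖A‖) ^ t :=
    mul_nonneg (div_nonneg (by positivity) (sq_nonneg _)) (pow_nonneg (div_nonneg hθ0 hl.le) t)
  have hδ0 : δ ≠ 0 := hδ.ne'
  have hl0 : ‖A‖ ≠ 0 := hl.ne'
  calc |D * n₂ - n₁ * n₃| ≤ 4 * ‖A‖ ^ t * θ ^ t * ‖M‖ ^ 2 * ‖(A ^ s) e‖ ^ 2 * ‖(A ^ r) e‖ ^ 2 := hnum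
    _ = 4 * ‖A‖ ^ t * θ ^ t * ‖M‖ ^ 2 * (‖(A ^ s) e‖ ^ 2 * ‖(A ^ r) e‖ ^ 2) := by ring
    _ ≤ 4 * ‖A‖ ^ t * θ ^ t * ‖M‖ ^ 2 * ((‖A‖ ^ s * a) ^ 2 * (‖A‖ ^ r * a) ^ 2) :=
        mul_le_mul_of_nonneg_left hXY hP
    _ = 4 * ‖M‖ ^ 2 * a ^ 4 / δ ^ 2 * (θ / ‖A‖) ^ t * (δ * ‖A‖ ^ (r + t + s)) ^ 2 := by
        rw [div_pow]
        field_simp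
        ring
    _ ≤ 4 * ‖M‖ ^ 2 * a ^ 4 / δ ^ 2 * (θ / ‖A‖) ^ t * D ^ 2 :=
        mul_le_mul_of_nonneg_left
          (pow_le_pow_left₀ (mul_nonneg hδ.le (pow_nonneg hl.le _)) hDlow 2) hKq

end AbstractHilbert

/-! #### §24a′ The same on a probability space: the open-chain moments of §22c under a gap -/

section AbstractKernel

variable {X : Type*} [MeasurableSpace X] {μ : Measure X} [IsProbabilityMeasure μ] {K : X → X → ℝ} {C : ℝ}
  {A : Lp ℝ 2 μ →L[ℝ] Lp ℝ 2 μ}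

/-- **Open-chain connected two-time function under a gap, in §22c's moment form (abstract, kernel).**  `A` the
self-adjoint `L²` operator of a bounded strongly measurable kernel on a probability space with the power-iteration gap
`θ < ‖A‖` towards the unit vector `φ`, `⟪φ, 𝟙⟫ ≠ 0`, positive open partition functions `⟪Aᵀ𝟙, 𝟙⟫ > 0`, `f` bounded
measurable.  Then ONE constant `K'` gives, for all `r, s` and `t ≥ 1`, with `T = r + t + s`:
`|I_T{s,s+t}/I_T∅ − (I_T{s}/I_T∅)(I_T{s+t}/I_T∅)| ≤ K' (θ/‖A‖)ᵗ` (`I_T S = insMoment μ K f T S`). [folklore] -/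
theorem exists_abs_insMomentRatio_le_of_gap (hK : StronglyMeasurable (uncurry K)) (hC : ∀ x y, ‖K x y‖ ≤ C)
    (hA : ∀ ψ : Lp ℝ 2 μ, (A ψ : X → ℝ) =ᵐ[μ] fun x => ∫ y, K x y * ψ y ∂μ) (hsa : IsSelfAdjoint A)
    {φ : Lp ℝ 2 μ} (hφ1 : ‖φ‖ = 1) {θ : ℝ} (hθ0 : 0 ≤ θ) (hθ : θ < ‖A‖)
    (hpow : ∀ (n : ℕ) (g : Lp ℝ 2 μ), ‖(A ^ n) g - (‖A‖ ^ n * ⟪φ, g⟫) • φ‖ ≤ θ ^ n * ‖g‖)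
    (hc : ⟪φ, lpOne μ⟫ ≠ 0) (hD : ∀ T : ℕ, 0 < ⟪(A ^ T) (lpOne μ), lpOne μ⟫)
    {f : X → ℝ} (hf : Measurable f) {B : ℝ} (hfb : ∀ x, ‖f x‖ ≤ B) (hB : 0 ≤ B) :
    ∃ K' : ℝ, ∀ (r s : ℕ) {t : ℕ}, 1 ≤ t →
      |insMoment μ K f (r + t + s) {s, s + t} / insMoment μ K f (r + t + s) ∅ -
          insMoment μ K f (r + t + s) {s} / insMoment μ K f (r + t + s) ∅ *
            (insMoment μ K f (r + t + s) {s + t} / insMoment μ K f (r + t + s) ∅)| ≤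
        K' * (θ / ‖A‖) ^ t := by
  obtain ⟨K', hK'⟩ := exists_abs_openRatio_le_of_gap hsa hφ1 hθ0 hθ hpow hc hD (mulL hf hfb)
  refine ⟨K', fun r s t ht => ?_⟩
  -- the partition function and the three un-normalised expectations as matrix elements (§22c)
  have hZ : insMoment μ K f (r + t + s) ∅ = ⟪(A ^ t) ((A ^ s) (lpOne μ)), (A ^ r) (lpOne μ)⟫ := by
    rw [insMoment_empty hA hsa f (r + t + s), pow_add, pow_add, mul_apply_eq_comp, mul_apply_eq_comp,
      (hsa.pow r).isSymmetric.apply_clm]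
  have hP : insMoment μ K f (r + t + s) {s, s + t} =
      ⟪(A ^ s) (lpOne μ), mulL hf hfb ((A ^ t) (mulL hf hfb ((A ^ r) (lpOne μ))))⟫ :=
    insMoment_pair hK hC hA hsa hf hfb hB r ht s
  have hrt : A ^ (r + t) = A ^ t * A ^ r := by rw [← pow_add, add_comm t r]
  have hst : A ^ (s + t) = A ^ t * A ^ s := by rw [← pow_add, add_comm t s]
  have hS1 : insMoment μ K f (r + t + s) {s} = ⟪(A ^ s) (lpOne μ), mulL hf hfb ((A ^ t) ((A ^ r) (lpOne μ)))⟫ := by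
    rw [insMoment_single hK hC hA hsa hf hfb hB (r + t) s, hrt, mul_apply_eq_comp]
  have hS2 : insMoment μ K f (r + t + s) {s + t} =
      ⟪(A ^ t) ((A ^ s) (lpOne μ)), mulL hf hfb ((A ^ r) (lpOne μ))⟫ := by
    have h := insMoment_single hK hC hA hsa hf hfb hB r (s + t)
    rw [show r + (s + t) = r + t + s by ring] at h
    rw [h, hst, mul_apply_eq_comp]
  rw [hP, hS1, hS2, hZ]
  exact hK' r t s

end AbstractKernel

/-! #### §24b Wilson's theory: the transfer gap ⇒ open-boundary time clustering of every bounded slice observable -/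

section Wilson

variable {G : Type} [Group G] [TopologicalSpace G] [IsTopologicalGroup G] [CompactSpace G]
  [MeasurableSpace G] [BorelSpace G] [SecondCountableTopology G] {N : ℕ} {ρ : G →* Matrix (Fin N) (Fin N) ℂ}
  (β : ℝ)

omit [Group G] [TopologicalSpace G] [IsTopologicalGroup G] [CompactSpace G] [BorelSpace G]
  [SecondCountableTopology G] in
/-- The class of all bounded measurable real slice functions on `G^{E₃}` (the largest class for which the open-boundary
expectations are matrix elements of `𝕋`). [folklore] -/
def boundedMeasurableClass (L : ℕ) : Set (GaugeConfig 3 L G → ℝ) :=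
  {f | Measurable f ∧ ∃ B : ℝ, ∀ U, ‖f U‖ ≤ B}

omit [Group G] [TopologicalSpace G] [IsTopologicalGroup G] [CompactSpace G] [BorelSpace G]
  [SecondCountableTopology G] in
/-- Membership in the bounded measurable class, unfolded. [folklore] -/
theorem mem_boundedMeasurableClass {L : ℕ} {f : GaugeConfig 3 L G → ℝ} :
    f ∈ boundedMeasurableClass (G := G) L ↔ Measurable f ∧ ∃ B : ℝ, ∀ U, ‖f U‖ ≤ B := Iff.rfl

/-- **CONVERSE CONVERSION THEOREM (kernel): JW's transfer gap at rate `m > 0` ⇒ open-boundary time clustering at rate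
`m` of EVERY class of bounded measurable slice observables, on every spatial torus `(ℤ/(2S+1))³`, for every real `β`
and every continuous unitary `ρ`.**  With `𝕋 = wilsonTorusTransferMatrix ρ β (2S+1)`, `Ω` the gap's vacuum and
`𝟙` the open theory's boundary state: `⟪Ω, 𝟙⟫ ≠ 0` because `Ω = ±|Ω|` with `|Ω| > 0` a.e. (positivity improvement,
tree `IsPositivityImproving.top_eigenvector_abs`), `Z^{open}(T) = ⟪𝕋ᵀ𝟙, 𝟙⟫ > 0` (§21), the gap gives the power-iteration
estimate (tree `norm_pow_apply_sub_le_of_gap`), and §24a bounds the connected two-time function of `f` by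
`K_f e^{−mt}` uniformly in `(s, T)`, the three open-boundary expectations being the matrix elements of §22c. [folklore] -/
theorem openBoundaryTimeClustering_of_transferOperatorGap (hρ : Continuous ρ)
    (hρu : ∀ g, ρ g ∈ Matrix.unitaryGroup (Fin N) ℂ) (S : ℕ) {m : ℝ} (hm : 0 < m)
    {𝒞 : Set (GaugeConfig 3 (2 * S + 1) G → ℝ)} (h𝒞 : 𝒞 ⊆ boundedMeasurableClass (2 * S + 1))
    (h : TransferOperatorGap ρ β S m) : OpenBoundaryTimeClustering ρ β (2 * S + 1) 𝒞 m := by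
  obtain ⟨C, hC⟩ := exists_norm_wilsonSliceKernel_le (L := 2 * S + 1) ρ hρ β
  have hK := stronglyMeasurable_uncurry_wilsonSliceKernel (L := 2 * S + 1) ρ hρ β
  have hA := wilsonTorusTransferMatrix_ae_eq β (2 * S + 1) hρ
  have hsa := isSelfAdjoint_wilsonTorusTransferMatrix (2 * S + 1) hρ hρu β
  have himp := isPositivityImproving_wilsonTorusTransferMatrix β (2 * S + 1) hρ
  obtain ⟨φ, hφ1, hAφ, hgap⟩ := h
  set A := wilsonTorusTransferMatrix ρ β (2 * S + 1)
  -- positivity of the open partition functions `Z^{open}(T) = ⟪𝕋ᵀ 𝟙, 𝟙⟫` (§21, in §22's normal form)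
  have hD : ∀ T : ℕ, 0 < insMoment (Measure.pi fun _ : Edge 3 (2 * S + 1) => haarProbability G)
      (wilsonSliceKernel ρ β) (fun _ => (0 : ℝ)) T ∅ := fun T => by
    rw [insMoment, sliceIns_empty, transferInsertion_one, ← openPartitionFunction_eq_integral_iterate β (2 * S + 1) hρ T]
    exact openPartitionFunction_pos β (2 * S + 1) hρ T
  simp only [insMoment_empty hA hsa] at hD
  have hA0 : A ≠ 0 := by
    intro h0
    have h1 := hD 1
    rw [pow_one, h0] at h1
    simp at h1
  have hl : 0 < ‖A‖ := norm_pos_iff.2 hA0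
  -- the gap in power-iteration form, `θ = e^{-m} ‖𝕋‖ < ‖𝕋‖`
  have hθ0 : 0 ≤ Real.exp (-m) * ‖A‖ := mul_nonneg (Real.exp_pos _).le hl.le
  have hθ : Real.exp (-m) * ‖A‖ < ‖A‖ := by
    have h1 : Real.exp (-m) < 1 := by simpa using Real.exp_lt_exp.2 (neg_lt_zero.2 hm)
    calc Real.exp (-m) * ‖A‖ < 1 * ‖A‖ := mul_lt_mul_of_pos_right h1 hl
      _ = ‖A‖ := one_mul _
  have hpow := norm_pow_apply_sub_le_of_gap hsa hφ1 hAφ hθ0 hgap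
  -- the vacuum overlaps the boundary state: `Ω = ±|Ω|`, `|Ω| > 0` a.e.
  have hφ0 : φ ≠ 0 := by rw [← norm_ne_zero_iff, hφ1]; exact one_ne_zero
  obtain ⟨habspos, -, hsign, -⟩ := himp.top_eigenvector_abs hsa hφ0 hAφ
  have h1pos : 0 < ⟪lpOne (Measure.pi fun _ : Edge 3 (2 * S + 1) => haarProbability G), |φ|⟫ := by
    refine inner_pos ⟨?_, lpOne_ne_zero (μ := Measure.pi fun _ : Edge 3 (2 * S + 1) => haarProbability G)⟩
      habspos
    exact (Lp.coeFn_nonneg _).1 (by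
      filter_upwards [lpOne_coeFn (μ := Measure.pi fun _ : Edge 3 (2 * S + 1) => haarProbability G)] with x hx
      simp [hx])
  have hc : ⟪φ, lpOne (Measure.pi fun _ : Edge 3 (2 * S + 1) => haarProbability G)⟫ ≠ 0 := by
    rw [real_inner_comm]
    rcases hsign with h2 | h2 <;> rw [h2]
    · exact h1pos.ne'
    · rw [inner_neg_right]; exact neg_ne_zero.2 h1pos.ne'
  -- the observable and its constant
  intro f hf
  obtain ⟨hfm, B, hfb⟩ := mem_boundedMeasurableClass.1 (h𝒞 hf)
  have hfb' : ∀ U, ‖f U‖ ≤ max B 0 := fun U => (hfb U).trans (le_max_left _ _)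
  have hB' : 0 ≤ max B 0 := le_max_right _ _
  obtain ⟨K', hK'⟩ := exists_abs_insMomentRatio_le_of_gap hK hC hA hsa hφ1 hθ0 hθ hpow hc hD hfm hfb' hB'
  have hq : Real.exp (-m) * ‖A‖ / ‖A‖ = Real.exp (-m) := mul_div_cancel_right₀ _ hl.ne'
  refine ⟨K', fun T s t ht hst => ?_⟩
  obtain ⟨r, rfl⟩ : ∃ r, T = r + t + s := ⟨T - (s + t), by omega⟩
  have hexp : (Real.exp (-m) * ‖A‖ / ‖A‖) ^ t = Real.exp (-(m * t)) := by
    rw [hq, ← Real.exp_nat_mul]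
    congr 1
    ring
  have h1 := hK' r s ht
  rw [hexp] at h1
  simpa only [openExpectation_sliceObs β (2 * S + 1) hρ hfm hfb'] using h1

/-- **EQUIVALENCE (kernel; `β ≥ 0`, `m > 0`, continuous unitary `ρ`): open-boundary time clustering of all bounded
measurable slice observables at rate `m` ⇔ JW's transfer gap at rate `m`** — §22's conversion and §24b's converse.  The
typed "what a volume-uniform open-boundary functional inequality would have to say" is neither weaker nor stronger than
the lattice mass gap on that torus, with the same rate. No claim about Yang–Mills. [folklore] -/
theorem openBoundaryTimeClustering_iff_transferOperatorGap (hρ : Continuous ρ)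
    (hρu : ∀ g, ρ g ∈ Matrix.unitaryGroup (Fin N) ℂ) {β : ℝ} (hβ : 0 ≤ β) (S : ℕ) {m : ℝ} (hm : 0 < m) :
    OpenBoundaryTimeClustering ρ β (2 * S + 1) (boundedMeasurableClass (2 * S + 1)) m ↔
      TransferOperatorGap ρ β S m :=
  ⟨fun h => transferOperatorGap_of_openBoundaryTimeClustering hρ hρu hβ S (𝒞 := boundedMeasurableClass (2 * S + 1))
      (fun _ hf B hB => ⟨hf, B, hB⟩) h,
    fun h => openBoundaryTimeClustering_of_transferOperatorGap β hρ hρu S hm subset_rfl h⟩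

/-- **Ground-state clustering ⇔ the transfer gap** (`β ≥ 0`, `m > 0`, continuous unitary `ρ`): §12's upgrade and, for the
converse, §24b followed by §22. [folklore] -/
theorem groundStateClustering_iff_transferOperatorGap (hρ : Continuous ρ)
    (hρu : ∀ g, ρ g ∈ Matrix.unitaryGroup (Fin N) ℂ) {β : ℝ} (hβ : 0 ≤ β) (S : ℕ) {m : ℝ} (hm : 0 < m) :
    GroundStateClustering ρ β S m ↔ TransferOperatorGap ρ β S m :=
  ⟨fun h => transferOperatorGap_of_groundStateClustering hρ hρu hβ S h, fun h =>
    groundStateClustering_of_openBoundaryTimeClustering β hρ hρu S (𝒞 := boundedMeasurableClass (2 * S + 1))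
      (fun _ hf B hB => ⟨hf, B, hB⟩)
      (openBoundaryTimeClustering_of_transferOperatorGap β hρ hρu S hm subset_rfl h)⟩

/-- **The transfer gap ⇒ ground-state clustering, for every real `β`** (`m > 0`; no reflection positivity needed in this
direction). [folklore] -/
theorem groundStateClustering_of_transferOperatorGap (hρ : Continuous ρ)
    (hρu : ∀ g, ρ g ∈ Matrix.unitaryGroup (Fin N) ℂ) (S : ℕ) {m : ℝ} (hm : 0 < m) (h : TransferOperatorGap ρ β S m) :
    GroundStateClustering ρ β S m :=
  groundStateClustering_of_openBoundaryTimeClustering β hρ hρu S (𝒞 := boundedMeasurableClass (2 * S + 1))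
    (fun _ hf B hB => ⟨hf, B, hB⟩)
    (openBoundaryTimeClustering_of_transferOperatorGap β hρ hρu S hm subset_rfl h)

omit [IsTopologicalGroup G] in
/-- The gauge-invariant link polynomials are bounded measurable slice functions. [folklore] -/
theorem polynomialInvariantClass_subset_boundedMeasurableClass (hρ : Continuous ρ) (L : ℕ) [NeZero L] :
    polynomialInvariantClass ρ L ⊆ boundedMeasurableClass (G := G) L := fun _ hF =>
  ⟨measurable_of_isLinkPolynomial hρ hF.2, exists_bound_of_isLinkPolynomial hρ hF.2⟩

omit [IsTopologicalGroup G] in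
/-- The gauge-invariant `ρ`-Lipschitz functions are bounded measurable slice functions. [folklore] -/
theorem lipschitzInvariantClass_subset_boundedMeasurableClass (hρ : Continuous ρ) (L : ℕ) [NeZero L] :
    lipschitzInvariantClass ρ L ⊆ boundedMeasurableClass (G := G) L := fun _ hF => by
  obtain ⟨K, hK⟩ := hF.2
  exact ⟨measurable_of_isTimeZeroLipschitz hρ hK, exists_bound_of_isTimeZeroLipschitz hρ hK⟩

/-- **EQUIVALENCE on Wilson loops (kernel; faithful continuous unitary `ρ`, `β ≥ 0`, `m > 0`):** uniform-in-`(s, T)`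
exponential clustering at lattice rate `m` of the open-temporal-boundary expectations of the gauge-invariant Wilson-loop
polynomials of one time slice ⇔ JW's transfer gap `e^{−m}` on that torus. [folklore] -/
theorem openBoundaryTimeClustering_polynomialClass_iff (hρ : Continuous ρ)
    (hρu : ∀ g, ρ g ∈ Matrix.unitaryGroup (Fin N) ℂ) (hρi : Function.Injective ρ) {β : ℝ} (hβ : 0 ≤ β) (S : ℕ)
    {m : ℝ} (hm : 0 < m) :
    OpenBoundaryTimeClustering ρ β (2 * S + 1) (polynomialInvariantClass ρ (2 * S + 1)) m ↔
      TransferOperatorGap ρ β S m :=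
  ⟨fun h => transferOperatorGap_of_openBoundaryTimeClustering_polynomialClass hρ hρu hρi hβ S h, fun h =>
    openBoundaryTimeClustering_of_transferOperatorGap β hρ hρu S hm
      (polynomialInvariantClass_subset_boundedMeasurableClass hρ (2 * S + 1)) h⟩

/-- **EQUIVALENCE on the functional-inequality class (kernel; faithful continuous unitary `ρ`, `β ≥ 0`, `m > 0`):**
open-boundary time clustering of the gauge-invariant `ρ`-Lipschitz slice functions at rate `m` ⇔ JW's transfer gap at
rate `m`. [folklore] -/
theorem openBoundaryTimeClustering_lipschitzClass_iff (hρ : Continuous ρ)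
    (hρu : ∀ g, ρ g ∈ Matrix.unitaryGroup (Fin N) ℂ) (hρi : Function.Injective ρ) {β : ℝ} (hβ : 0 ≤ β) (S : ℕ)
    {m : ℝ} (hm : 0 < m) :
    OpenBoundaryTimeClustering ρ β (2 * S + 1) (lipschitzInvariantClass ρ (2 * S + 1)) m ↔
      TransferOperatorGap ρ β S m :=
  ⟨fun h => transferOperatorGap_of_openBoundaryTimeClustering_lipschitzClass hρ hρu hρi hβ S h, fun h =>
    openBoundaryTimeClustering_of_transferOperatorGap β hρ hρu S hm
      (lipschitzInvariantClass_subset_boundedMeasurableClass hρ (2 * S + 1)) h⟩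

/-- **All classes between Wilson-loop polynomials and bounded measurable functions are interchangeable in the hypothesis
(faithful `ρ`, `β ≥ 0`, `m > 0`):** clustering of the small class at rate `m` gives clustering of the big class at the
same rate (through the gap) — the observable class is not where the content of the hypothesis lies. [folklore] -/
theorem openBoundaryTimeClustering_boundedMeasurableClass_of_polynomialClass (hρ : Continuous ρ)
    (hρu : ∀ g, ρ g ∈ Matrix.unitaryGroup (Fin N) ℂ) (hρi : Function.Injective ρ) {β : ℝ} (hβ : 0 ≤ β) (S : ℕ)
    {m : ℝ} (hm : 0 < m)
    (h : OpenBoundaryTimeClustering ρ β (2 * S + 1) (polynomialInvariantClass ρ (2 * S + 1)) m) :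
    OpenBoundaryTimeClustering ρ β (2 * S + 1) (boundedMeasurableClass (2 * S + 1)) m :=
  (openBoundaryTimeClustering_iff_transferOperatorGap hρ hρu hβ S hm).2
    ((openBoundaryTimeClustering_polynomialClass_iff hρ hρu hρi hβ S hm).1 h)

end Wilson

end Literature.MathematicalPhysics.QuantumFieldTheory.Balaban1983to89.Sufficient.OpenBoundary

end
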